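import Mathlib
import Summits.Ventures.HodgeRepro2.Tier7.Line3.SplitFactorConstants
import Summits.Ventures.HodgeRepro2.Tier7.Line3.CoverCountAdditivity

/-!
# Tier7/Line3/CoverCountLink — THE COUNT-SIDE LINK: the split-place box count over a finite cover by double cosets

Filer: t7-L1-p3 (gen 9, prover-pub-hodge-repro2-t7-L1-p3-g9-0), ASSIGNED by t7-plan-3's TWIN RULING (STATUS l. 16077,
layer (B); crit-2 g4 precision (iv) l. 16070; census (h⁵⁗‴)). Layer (A) = L1-p2's DoubleCosetCover (p714118) +
CoverCountAdditivity (p714200), IMPORTED. Lane: Line 3 SUPPORT, [M]-level consolidation of the split-place row; NOT a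
line, NOT a device; touches neither residual clause (a′) nor (b′) of the line.

WHAT IT SUPPLIES. SplitFactorConstants (p711068) takes the per-place bound `b w γ ≤ Cw w · (1 + e₁)(1 + e₂)` as a
DISPLAYED hypothesis and leaves «the finite cover of `U = supp f_w` by double cosets that fixes `Cw w`» in words. This
file makes that bound a THEOREM of the displayed cover: for a support set `U ⊆ ⋃_{j ∈ T} D j` (`T` finite) whose
pieces satisfy the displayed shape of membership in `K ϖ^{(m_j, n_j)} K` — «every entry of value `≤ u_j`, determinant of
value `δ_j`» with the Cartan data `ord u_j = −min (m_j, n_j)`, `ord δ_j = −(m_j + n_j)` —, the number of value pairs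
`(v s₁, v s₂)` of the solutions `(t₂, s₁, s₂)` of `t⁻¹ γ s ∈ U` (p1's split-place coordinates) is at most
`∑_{j ∈ T} (1 + e₁ + |m_j − n_j|)₊ (1 + e₂ + |m_j − n_j|)₊ ≤ (∑_{j ∈ T} (1 + |m_j − n_j|)²) · (1 + M₁)(1 + M₂)` for any
`M₁ ≥ e₁`, `M₂ ≥ e₂`. Here `e₁ := ord (v det) − ord (v a) − ord (v d)` and `e₂ := ord (v det) − ord (v b) − ord (v c)` are
DETERMINED by `(a, b, c, d)` through SplitOrbitBox's `ord` (`toAdd ∘ unzero`, the negative of the usual additive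
valuation; x1's exponents of `ad/det`, `bc/det`, i.e. `e₁ = v_w⁺(κ)`, `e₂ = v_w⁺(κ − 1)` in the additive picture), and
`M₁`, `M₂` are free parameters entering only through `he₁ : e₁ ≤ M₁`, `he₂ : e₂ ≤ M₂` (crit-2 l. 16135 (P2)); in the
consumer (CoverCountCartan §E3) they are `multiplicity w.asIdeal (I γ)` / `(J γ)` — the displayed (h⁵⁗) dictionary clause «`1 + v_w⁺(κ) ≤ 1 + mult_w (I γ)`»
of plan-3 l. 15989 (b) / l. 16137 (3), the link to NumeratorNorm / NumeratorIdealSize. THE THREE STEPS (plan-3 l. 16073 (2) / l. 16077 (B)):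
* the union bound — L1-p2's `ncard_biUnion_le` (Tier7/Line3/CoverCountAdditivity, layer (A)), IMPORTED, not restated;
* the per-coset count — SplitFactorConstants' `ncard_slackBox_le` (the slack box of `(u_j, δ_j)`), via
  `image_valuePair_sol_subset_slackBox` (one coset, one slack box: `mem_slackBox_of_bounds`) and the finiteness
  `slackBox_finite` / `image_valuePair_sol_finite` — THE JUNK-VALUE GUARD IS DISCHARGED BY FINITENESS (plan-3 l. 16137 (1),
  crit-2 l. 16135 (P1) / l. 16139): `Set.ncard` of an infinite set is `0`, so `Set.ncard_le_ncard` needs the finite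
  superset; here EVERY slack box is finite because its lower ends `δ·v d/(u·v det)`, `δ·v c/(u·v det)` are non-zero —
  which is why the four non-vanishing hypotheses `a, b, c, d ≠ 0` (and `det ≠ 0`) are binders of every count theorem
  below and propagate to C3 and CoverCountCartan; (A)'s unconditional `ncard_biUnion_le` is then used on finite
  pieces only (no infinite piece anywhere; the `hfin`-form `ncard_image_le_sum_of_cover` is not needed);
* the trivial arithmetic `(1 + e + A)₊ ≤ (1 + A)(1 + M)` for `A ≥ 0`, `e ≤ M`, `M ≥ 0` (`toNat_mul_le`; no sign condition
  on `e`: at a pole of `κ` the per-coset count is still `≤ (1 + A)`).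
Sections: C1 the solution set `sol`, the value-pair map `valuePair`, the slack box `slackBox` (any value group);
C2 the count over a finite cover (`ncard_image_valuePair_sol_le`, general coset data); C3 the Cartan form
(`ncard_image_valuePair_sol_le_cartan`), the constant (`…_const`, integers) and the real form `…_real` =
SplitFactorConstants' `hb` verbatim with `Cw := max 1 (∑_j (1 + |m_j − n_j|)²)`. The consumer
`exists_splitFactor_le_of_covers` (= SplitFactorConstants' `exists_splitFactor_le_const` with `hb` DISCHARGED at every
place, one constant `C` for all `γ` from per-place covers) and the composite at a CARTAN cover (`hD`, `hm`, `hn`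
discharged by CosetEntryBounds p714165) are in the companion file CoverCountCartan (the 400-line rule).

WHAT STAYS IN WORDS (the dictionary, (a′) — plan-3 l. 16077): that `b w γ` IS `#(valuePair '' sol … (U w))` for the real
`U_γ = {(t, s) : t⁻¹ γ s ∈ supp f_w}` — for the `γ` with all four entries non-zero at `w`, which are exactly the `γ` of the
split row (`κ(γ) ∉ {0, 1}`, (h⁵″)'s displayed `hI / hJ`; plan-3 l. 16142 (ii): not a narrowing; crit-2 l. 16135 (P1)); that each coset met has the displayed entry/determinant shape with its Cartan
index `(m_j, n_j)` — a THEOREM of `K ⊆ GL₂(O)` and the Cartan representative by CosetEntryBounds, composed in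
CoverCountCartan; the Cartan decomposition `K\GL₂(F_w)/K ≅ {(m, n) : m ≥ n}` itself and the cost
`c (mk ϖ^{(m,n)}) = (1 + |m − n|)²` of DoubleCosetCover's `coverSum`; that `e₁ ≤ ord_w (I γ)`, `e₂ ≤ ord_w (J γ)` for the
numerator ideals of `κ(γ)`, `κ(γ) − 1`; the place datum. Nothing here is about (N), (P), the real `X`, or HC_CM. §8(d): NO. Blind lane: Mathlib +
the HodgeRepro2 prefix; no sorry; axioms ⊆ {propext, Classical.choice, Quot.sound}.
-/

namespace Summit.Ventures.HodgeRepro2.Tier7.Line3.CoverCountLink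

open Matrix Summit.Ventures.HodgeRepro2.Tier7.Line3.SplitOrbitBox
  Summit.Ventures.HodgeRepro2.Tier7.Line3.SplitFactorConstants
  Summit.Ventures.HodgeRepro2.Tier7.Line3.CoverCountAdditivity

/-! ## C1. The solution set, the value-pair map and the slack box (any value group) -/

section Model

variable {F : Type*} [Field F] {Γ₀ : Type*} [LinearOrderedCommGroupWithZero Γ₀]

/-- **the conjugated matrix** `diag(1, t₂⁻¹) · γ · diag(s₁, s₂)` of p1's split-place coordinates
(`T7SupportSplitOrbit`: `t = diagonal (1, t₂)`, `s = diagonal (s₁, s₂)`), for the parameter triple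
`p = (t₂, s₁, s₂)` and `γ = !![a, b; c, d]`. -/
def conjMat (a b c d : F) (p : F × F × F) : Matrix (Fin 2) (Fin 2) F :=
  diagonal ![1, p.1⁻¹] * !![a, b; c, d] * diagonal ![p.2.1, p.2.2]

/-- **the solution set of a support set `U`**: the parameter triples `(t₂, s₁, s₂)` with non-zero entries
whose conjugated matrix `t⁻¹ γ s` lies in `U` (for `U = supp f_w` this is the set the real box count `b w γ`
is read off from — that identification is the dictionary, in words). The count theorems below take `a, b, c, d ≠ 0`
(and `det ≠ 0`) as binders — NOT a narrowing (plan-3 l. 16142 (ii)): SplitOrbitBox's box already needs them, and in the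
adapted basis `κ = ad/det`, so `κ(γ) ∉ {0, 1} ⟺ a, b, c, d ≠ 0` — the `γ` the split row counts are exactly the `γ` with
four non-zero entries (the (T × T)-regular ones, (h⁵″)'s displayed `hI / hJ`); a `γ` with a zero entry is not a term of
the split row (its value-pair set is infinite, `Set.ncard` would be the junk value `0`). -/
def sol (a b c d : F) (U : Set (Matrix (Fin 2) (Fin 2) F)) : Set (F × F × F) :=
  {p | p.1 ≠ 0 ∧ p.2.1 ≠ 0 ∧ p.2.2 ≠ 0 ∧ conjMat a b c d p ∈ U}

/-- the solution set is monotone in the support set. -/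
theorem sol_mono {a b c d : F} {U U' : Set (Matrix (Fin 2) (Fin 2) F)} (h : U ⊆ U') :
    sol a b c d U ⊆ sol a b c d U' :=
  fun _ hp => ⟨hp.1, hp.2.1, hp.2.2.1, h hp.2.2.2⟩

/-- the solution set of a finite union of support sets lies in the union of the solution sets. -/
theorem sol_biUnion_subset {ι : Type*} (a b c d : F) (T : Finset ι)
    (D : ι → Set (Matrix (Fin 2) (Fin 2) F)) :
    sol a b c d (⋃ j ∈ T, D j) ⊆ ⋃ j ∈ T, sol a b c d (D j) := by
  rintro p ⟨h1, h2, h3, h4⟩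
  obtain ⟨j, hj, hpj⟩ := Set.mem_iUnion₂.1 h4
  exact Set.mem_iUnion₂.2 ⟨j, hj, h1, h2, h3, hpj⟩

/-- **the value-pair map** `(t₂, s₁, s₂) ↦ (v s₁, v s₂)` of `valuePair_mem_slackBox` / `valuePair_mem_box`. -/
def valuePair (v : Valuation F Γ₀) (p : F × F × F) : Γ₀ × Γ₀ := (v p.2.1, v p.2.2)

/-- **the slack box** of a coset datum `(u, δ)` (SplitFactorConstants `mem_slackBox_of_bounds`): the product of
the two shifted intervals `[δ·v d/(u·v det), u·(v a)⁻¹] × [δ·v c/(u·v det), u·(v b)⁻¹]`. -/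
def slackBox (v : Valuation F Γ₀) (a b c d : F) (u δ : Γ₀) : Set (Γ₀ × Γ₀) :=
  {X : Γ₀ | δ * v d / (u * v (a * d - b * c)) ≤ X ∧ X ≤ u * (v a)⁻¹} ×ˢ
    {Y : Γ₀ | δ * v c / (u * v (a * d - b * c)) ≤ Y ∧ Y ≤ u * (v b)⁻¹}

/-- **one coset, one slack box**: if every matrix of `D` has all entries of value `≤ u` and determinant of value
`δ` (the displayed shape of membership in `K ϖ^{(m,n)} K`), the value pairs of the solutions of `D` lie in the
slack box of `(u, δ)`. -/
theorem image_valuePair_sol_subset_slackBox (v : Valuation F Γ₀) (a b c d : F) (u δ : Γ₀)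
    (ha : a ≠ 0) (hb : b ≠ 0) (hdet : a * d - b * c ≠ 0) (hu : u ≠ 0) (hδ : δ ≠ 0)
    (D : Set (Matrix (Fin 2) (Fin 2) F))
    (hD : ∀ M ∈ D, (∀ i k, v (M i k) ≤ u) ∧ v M.det = δ) :
    valuePair v '' sol a b c d D ⊆ slackBox v a b c d u δ := by
  rintro _ ⟨p, ⟨ht, hs₁, hs₂, hM⟩, rfl⟩
  obtain ⟨hint, hdet'⟩ := hD _ hM
  obtain ⟨⟨h1, h2⟩, ⟨h3, h4⟩, -⟩ :=
    mem_slackBox_of_bounds v a b c d p.1 p.2.1 p.2.2 u δ ha hb hdet ht hs₁ hs₂ hu hδ hint hdet'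
  exact ⟨⟨h1, h2⟩, ⟨h3, h4⟩⟩

end Model

/-! ## C2. The count over a finite cover (discrete valuation) -/

section Discrete

open WithZero Multiplicative

variable {F : Type*} [Field F]

/-- the non-zero values `X` with `lo ≤ X ≤ hi` of a discrete valuation form a FINITE set (`lo ≠ 0`): `X ↦ ord X`
injects it into `Finset.Icc (ord lo) (ord hi)` (x1's `ncard_Icc_le` counts it; here the finiteness itself, which
`Set.ncard_le_ncard` needs). -/
theorem interval_finite (lo hi : WithZero (Multiplicative ℤ)) (hlo : lo ≠ 0) :
    {X : WithZero (Multiplicative ℤ) | lo ≤ X ∧ X ≤ hi}.Finite := by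
  classical
  have hmem : ∀ X ∈ {X : WithZero (Multiplicative ℤ) | lo ≤ X ∧ X ≤ hi}, X ≠ 0 := by
    rintro X ⟨h1, -⟩ hX0
    rw [hX0] at h1
    exact hlo (le_antisymm h1 zero_le)
  by_cases hhi : hi = 0
  · have hempty : {X : WithZero (Multiplicative ℤ) | lo ≤ X ∧ X ≤ hi} = ∅ := by
      ext X
      simp only [Set.mem_setOf_eq, Set.mem_empty_iff_false, iff_false, not_and]
      intro h1 h2
      exact hmem X ⟨h1, h2⟩ (le_antisymm (hhi ▸ h2) zero_le)
    rw [hempty]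
    exact Set.finite_empty
  · let f : WithZero (Multiplicative ℤ) → ℤ := fun X => if h : X ≠ 0 then ord h else 0
    have hmaps : f '' {X : WithZero (Multiplicative ℤ) | lo ≤ X ∧ X ≤ hi} ⊆
        (Finset.Icc (ord hlo) (ord hhi) : Set ℤ) := by
      rintro _ ⟨X, ⟨h1, h2⟩, rfl⟩
      have hX : X ≠ 0 := hmem X ⟨h1, h2⟩
      simp only [f, dif_pos hX, Finset.coe_Icc, Set.mem_Icc]
      exact ⟨ord_le_ord hlo hX h1, ord_le_ord hX hhi h2⟩
    have hinj : Set.InjOn f {X : WithZero (Multiplicative ℤ) | lo ≤ X ∧ X ≤ hi} := by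
      intro X hX Y hY hXY
      have hX0 : X ≠ 0 := hmem X hX
      have hY0 : Y ≠ 0 := hmem Y hY
      simp only [f, dif_pos hX0, dif_pos hY0, ord] at hXY
      have h1 : unzero hX0 = unzero hY0 := toAdd.injective hXY
      rw [← coe_unzero hX0, ← coe_unzero hY0, h1]
    exact Set.Finite.of_finite_image ((Finset.finite_toSet _).subset hmaps) hinj

/-- the slack box of a discrete valuation is finite (both lower ends are non-zero). -/
theorem slackBox_finite (v : Valuation F (WithZero (Multiplicative ℤ))) (a b c d : F)
    (u δ : WithZero (Multiplicative ℤ))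
    (hc : c ≠ 0) (hd : d ≠ 0) (hdet : a * d - b * c ≠ 0) (hu : u ≠ 0) (hδ : δ ≠ 0) :
    (slackBox v a b c d u δ).Finite := by
  have hd0 : v d ≠ 0 := (Valuation.ne_zero_iff v).2 hd
  have hc0 : v c ≠ 0 := (Valuation.ne_zero_iff v).2 hc
  have hD0 : v (a * d - b * c) ≠ 0 := (Valuation.ne_zero_iff v).2 hdet
  exact Set.Finite.prod
    (interval_finite _ _ (div_ne_zero (mul_ne_zero hδ hd0) (mul_ne_zero hu hD0)))
    (interval_finite _ _ (div_ne_zero (mul_ne_zero hδ hc0) (mul_ne_zero hu hD0)))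

/-- the per-coset count, restated on `slackBox`: SplitFactorConstants' `ncard_slackBox_le`. -/
theorem ncard_slackBox_le' (v : Valuation F (WithZero (Multiplicative ℤ))) (a b c d : F)
    (u δ : WithZero (Multiplicative ℤ))
    (ha : a ≠ 0) (hb : b ≠ 0) (hc : c ≠ 0) (hd : d ≠ 0) (hdet : a * d - b * c ≠ 0) (hu : u ≠ 0) (hδ : δ ≠ 0) :
    (slackBox v a b c d u δ).ncard ≤
      (1 + (ord ((Valuation.ne_zero_iff v).2 hdet) - ord ((Valuation.ne_zero_iff v).2 ha) -
            ord ((Valuation.ne_zero_iff v).2 hd)) + 2 * ord hu - ord hδ).toNat *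
        (1 + (ord ((Valuation.ne_zero_iff v).2 hdet) - ord ((Valuation.ne_zero_iff v).2 hb) -
            ord ((Valuation.ne_zero_iff v).2 hc)) + 2 * ord hu - ord hδ).toNat :=
  ncard_slackBox_le v a b c d u δ ha hb hc hd hdet hu hδ

/-- **the finiteness is honest** (crit-2 l. 16135 (P1)(i) / l. 16139): under the four non-vanishing hypotheses
`a, b, c, d ≠ 0` (and `det ≠ 0`, `u j, δ j ≠ 0`) the set of value pairs of the solutions of a finitely covered support
set is FINITE — it lies in the finite union of the slack boxes. So `Set.ncard` below is the true cardinality, not the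
junk value `0` of an infinite set; for a `γ` with a zero entry the statements are not made (the real sum's degenerate
terms are in words). -/
theorem image_valuePair_sol_finite (v : Valuation F (WithZero (Multiplicative ℤ))) (a b c d : F)
    (ha : a ≠ 0) (hb : b ≠ 0) (hc : c ≠ 0) (hd : d ≠ 0) (hdet : a * d - b * c ≠ 0)
    {ι : Type*} (T : Finset ι) (D : ι → Set (Matrix (Fin 2) (Fin 2) F))
    (u δ : ι → WithZero (Multiplicative ℤ)) (hu : ∀ j, u j ≠ 0) (hδ : ∀ j, δ j ≠ 0)
    (hD : ∀ j ∈ T, ∀ M ∈ D j, (∀ i k, v (M i k) ≤ u j) ∧ v M.det = δ j)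
    (U : Set (Matrix (Fin 2) (Fin 2) F)) (hcov : U ⊆ ⋃ j ∈ T, D j) :
    (valuePair v '' sol a b c d U).Finite := by
  have hsub : valuePair v '' sol a b c d U ⊆ ⋃ j ∈ T, slackBox v a b c d (u j) (δ j) := by
    rintro _ ⟨p, hp, rfl⟩
    obtain ⟨j, hj, hpj⟩ := Set.mem_iUnion₂.1 (sol_biUnion_subset a b c d T D (sol_mono hcov hp))
    exact Set.mem_iUnion₂.2 ⟨j, hj,
      image_valuePair_sol_subset_slackBox v a b c d (u j) (δ j) ha hb hdet (hu j) (hδ j) (D j) (hD j hj)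
        ⟨p, hpj, rfl⟩⟩
  exact ((Finset.finite_toSet T).biUnion fun j _ =>
    slackBox_finite v a b c d (u j) (δ j) hc hd hdet (hu j) (hδ j)).subset hsub

/-- **THE COUNT-SIDE LINK (general coset data)**: for a finite family of support pieces `D j`, `j ∈ T`, each
inside the displayed shape «entries of value `≤ u j`, determinant of value `δ j`», and a support set
`U ⊆ ⋃_{j ∈ T} D j`, the number of value pairs of the solutions of `U` is at most the sum over `j ∈ T` of the
slack-box counts `(1 + e₁ + 2·ord u_j − ord δ_j)₊ · (1 + e₂ + 2·ord u_j − ord δ_j)₊`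
(`e₁ = ord (v det) − ord (v a) − ord (v d)`, `e₂ = ord (v det) − ord (v b) − ord (v c)`).
The union bound is L1-p2's `ncard_biUnion_le` (CoverCountAdditivity, layer (A)); the per-coset count is
`ncard_slackBox_le`. -/
theorem ncard_image_valuePair_sol_le (v : Valuation F (WithZero (Multiplicative ℤ))) (a b c d : F)
    (ha : a ≠ 0) (hb : b ≠ 0) (hc : c ≠ 0) (hd : d ≠ 0) (hdet : a * d - b * c ≠ 0)
    {ι : Type*} (T : Finset ι) (D : ι → Set (Matrix (Fin 2) (Fin 2) F))
    (u δ : ι → WithZero (Multiplicative ℤ)) (hu : ∀ j, u j ≠ 0) (hδ : ∀ j, δ j ≠ 0)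
    (hD : ∀ j ∈ T, ∀ M ∈ D j, (∀ i k, v (M i k) ≤ u j) ∧ v M.det = δ j)
    (U : Set (Matrix (Fin 2) (Fin 2) F)) (hcov : U ⊆ ⋃ j ∈ T, D j) :
    (valuePair v '' sol a b c d U).ncard ≤
      ∑ j ∈ T, (1 + (ord ((Valuation.ne_zero_iff v).2 hdet) - ord ((Valuation.ne_zero_iff v).2 ha) -
            ord ((Valuation.ne_zero_iff v).2 hd)) + 2 * ord (hu j) - ord (hδ j)).toNat *
        (1 + (ord ((Valuation.ne_zero_iff v).2 hdet) - ord ((Valuation.ne_zero_iff v).2 hb) -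
            ord ((Valuation.ne_zero_iff v).2 hc)) + 2 * ord (hu j) - ord (hδ j)).toNat := by
  classical
  have hsub : valuePair v '' sol a b c d U ⊆ ⋃ j ∈ T, slackBox v a b c d (u j) (δ j) := by
    rintro _ ⟨p, hp, rfl⟩
    obtain ⟨j, hj, hpj⟩ := Set.mem_iUnion₂.1 (sol_biUnion_subset a b c d T D (sol_mono hcov hp))
    exact Set.mem_iUnion₂.2 ⟨j, hj,
      image_valuePair_sol_subset_slackBox v a b c d (u j) (δ j) ha hb hdet (hu j) (hδ j) (D j) (hD j hj)
        ⟨p, hpj, rfl⟩⟩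
  have hfin : (⋃ j ∈ T, slackBox v a b c d (u j) (δ j)).Finite :=
    (Finset.finite_toSet T).biUnion fun j _ => slackBox_finite v a b c d (u j) (δ j) hc hd hdet (hu j) (hδ j)
  calc (valuePair v '' sol a b c d U).ncard
      ≤ (⋃ j ∈ T, slackBox v a b c d (u j) (δ j)).ncard := Set.ncard_le_ncard hsub hfin
    _ ≤ ∑ j ∈ T, (slackBox v a b c d (u j) (δ j)).ncard :=
        ncard_biUnion_le T fun j => slackBox v a b c d (u j) (δ j)
    _ ≤ _ := Finset.sum_le_sum fun j _ => ncard_slackBox_le' v a b c d (u j) (δ j) ha hb hc hd hdet (hu j) (hδ j)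

end Discrete

/-! ## C3. Cartan data and the constant -/

section Cartan

open WithZero Multiplicative

variable {F : Type*} [Field F]

/-- `2·ord u − ord δ = |m − n|` for the Cartan datum of `K ϖ^{(m,n)} K` (`ord u = −min m n`, `ord δ = −(m + n)`,
in the convention `ord (v ϖ) = −1`). -/
theorem two_ord_sub_ord_eq_abs {u δ : WithZero (Multiplicative ℤ)} (hu : u ≠ 0) (hδ : δ ≠ 0) (m n : ℤ)
    (hm : ord hu = -min m n) (hn : ord hδ = -(m + n)) : 2 * ord hu - ord hδ = |m - n| := by
  rw [hm, hn, abs_eq_max_neg]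
  rcases le_total m n with h | h
  · rw [min_eq_left h, max_eq_right (by linarith)]; ring
  · rw [min_eq_right h, max_eq_left (by linarith)]; ring

/-- **THE COUNT-SIDE LINK (Cartan data)**: with the displayed Cartan data `(m j, n j)` of the cosets,
`ord (u j) = −min (m j) (n j)` and `ord (δ j) = −(m j + n j)`, the bound reads
`∑_{j ∈ T} (1 + e₁ + |m_j − n_j|)₊ · (1 + e₂ + |m_j − n_j|)₊` (plan-3 l. 16077 (B)). -/
theorem ncard_image_valuePair_sol_le_cartan (v : Valuation F (WithZero (Multiplicative ℤ))) (a b c d : F)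
    (ha : a ≠ 0) (hb : b ≠ 0) (hc : c ≠ 0) (hd : d ≠ 0) (hdet : a * d - b * c ≠ 0)
    {ι : Type*} (T : Finset ι) (D : ι → Set (Matrix (Fin 2) (Fin 2) F))
    (u δ : ι → WithZero (Multiplicative ℤ)) (hu : ∀ j, u j ≠ 0) (hδ : ∀ j, δ j ≠ 0)
    (m n : ι → ℤ) (hm : ∀ j, ord (hu j) = -min (m j) (n j)) (hn : ∀ j, ord (hδ j) = -(m j + n j))
    (hD : ∀ j ∈ T, ∀ M ∈ D j, (∀ i k, v (M i k) ≤ u j) ∧ v M.det = δ j)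
    (U : Set (Matrix (Fin 2) (Fin 2) F)) (hcov : U ⊆ ⋃ j ∈ T, D j) :
    (valuePair v '' sol a b c d U).ncard ≤
      ∑ j ∈ T, (1 + (ord ((Valuation.ne_zero_iff v).2 hdet) - ord ((Valuation.ne_zero_iff v).2 ha) -
            ord ((Valuation.ne_zero_iff v).2 hd)) + |m j - n j|).toNat *
        (1 + (ord ((Valuation.ne_zero_iff v).2 hdet) - ord ((Valuation.ne_zero_iff v).2 hb) -
            ord ((Valuation.ne_zero_iff v).2 hc)) + |m j - n j|).toNat := by
  have h := ncard_image_valuePair_sol_le v a b c d ha hb hc hd hdet T D u δ hu hδ hD U hcov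
  refine h.trans (le_of_eq (Finset.sum_congr rfl fun j _ => ?_))
  rw [add_sub_assoc, add_sub_assoc, two_ord_sub_ord_eq_abs (hu j) (hδ j) (m j) (n j) (hm j) (hn j)]

/-- the trivial arithmetic `(1 + e + A)₊ · (1 + e' + A)₊ ≤ (1 + A)² · ((1 + M) · (1 + M'))` for `A ≥ 0` and any
integers `e ≤ M`, `e' ≤ M'` with `M, M' ≥ 0` (no sign condition on `e`, `e'`: at a pole of `κ` the count is still
bounded by the trivial-coset value), in the `toNat` form the counts come in. -/
theorem toNat_mul_le (A e e' M M' : ℤ) (hA : 0 ≤ A) (hM : 0 ≤ M) (hM' : 0 ≤ M') (he : e ≤ M) (he' : e' ≤ M') :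
    (((1 + e + A).toNat * (1 + e' + A).toNat : ℕ) : ℤ) ≤ (1 + A) ^ 2 * ((1 + M) * (1 + M')) := by
  have h1 : 1 + e + A ≤ (1 + A) * (1 + M) := by nlinarith
  have h2 : 1 + e' + A ≤ (1 + A) * (1 + M') := by nlinarith
  have h1' : ((1 + e + A).toNat : ℤ) ≤ (1 + A) * (1 + M) := by
    have := Int.toNat_le_toNat h1
    have h := Int.toNat_of_nonneg (show (0 : ℤ) ≤ (1 + A) * (1 + M) by positivity)
    calc ((1 + e + A).toNat : ℤ) ≤ (((1 + A) * (1 + M)).toNat : ℤ) := by exact_mod_cast this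
      _ = (1 + A) * (1 + M) := h
  have h2' : ((1 + e' + A).toNat : ℤ) ≤ (1 + A) * (1 + M') := by
    have := Int.toNat_le_toNat h2
    have h := Int.toNat_of_nonneg (show (0 : ℤ) ≤ (1 + A) * (1 + M') by positivity)
    calc ((1 + e' + A).toNat : ℤ) ≤ (((1 + A) * (1 + M')).toNat : ℤ) := by exact_mod_cast this
      _ = (1 + A) * (1 + M') := h
  push_cast
  calc ((1 + e + A).toNat : ℤ) * ((1 + e' + A).toNat : ℤ)
      ≤ ((1 + A) * (1 + M)) * ((1 + A) * (1 + M')) :=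
        mul_le_mul h1' h2' (by positivity) (by positivity)
    _ = (1 + A) ^ 2 * ((1 + M) * (1 + M')) := by ring

/-- **THE COUNT-SIDE LINK WITH THE CONSTANT**: for integers `M₁ ≥ e₁`, `M₂ ≥ e₂`, `M₁, M₂ ≥ 0`,
`#(value pairs) ≤ (∑_{j ∈ T} (1 + |m_j − n_j|)²) · (1 + M₁)(1 + M₂)` — SplitFactorConstants' displayed per-place
bound `hb` with `Cw = ∑_j (1 + |m_j − n_j|)²` (the cost `c (mk ϖ^{(m,n)}) = (1 + |m − n|)²` of
DoubleCosetCover's `coverSum`, summed over the cover), as a theorem of the displayed cover. -/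
theorem ncard_image_valuePair_sol_le_const (v : Valuation F (WithZero (Multiplicative ℤ))) (a b c d : F)
    (ha : a ≠ 0) (hb : b ≠ 0) (hc : c ≠ 0) (hd : d ≠ 0) (hdet : a * d - b * c ≠ 0)
    {ι : Type*} (T : Finset ι) (D : ι → Set (Matrix (Fin 2) (Fin 2) F))
    (u δ : ι → WithZero (Multiplicative ℤ)) (hu : ∀ j, u j ≠ 0) (hδ : ∀ j, δ j ≠ 0)
    (m n : ι → ℤ) (hm : ∀ j, ord (hu j) = -min (m j) (n j)) (hn : ∀ j, ord (hδ j) = -(m j + n j))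
    (hD : ∀ j ∈ T, ∀ M ∈ D j, (∀ i k, v (M i k) ≤ u j) ∧ v M.det = δ j)
    (U : Set (Matrix (Fin 2) (Fin 2) F)) (hcov : U ⊆ ⋃ j ∈ T, D j)
    (M₁ M₂ : ℤ) (hM₁ : 0 ≤ M₁) (hM₂ : 0 ≤ M₂)
    (he₁ : ord ((Valuation.ne_zero_iff v).2 hdet) - ord ((Valuation.ne_zero_iff v).2 ha) -
            ord ((Valuation.ne_zero_iff v).2 hd) ≤ M₁)
    (he₂ : ord ((Valuation.ne_zero_iff v).2 hdet) - ord ((Valuation.ne_zero_iff v).2 hb) -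
            ord ((Valuation.ne_zero_iff v).2 hc) ≤ M₂) :
    ((valuePair v '' sol a b c d U).ncard : ℤ) ≤
      (∑ j ∈ T, (1 + |m j - n j|) ^ 2) * ((1 + M₁) * (1 + M₂)) := by
  have h := ncard_image_valuePair_sol_le_cartan v a b c d ha hb hc hd hdet T D u δ hu hδ m n hm hn hD U hcov
  have h' := (Nat.cast_le (α := ℤ)).2 h
  refine h'.trans ?_
  push_cast
  rw [Finset.sum_mul]
  exact Finset.sum_le_sum fun j _ => by
    have := toNat_mul_le (|m j - n j|) _ _ M₁ M₂ (abs_nonneg _) hM₁ hM₂ he₁ he₂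
    push_cast at this
    exact this

/-- **the real form for the consumer** (SplitFactorConstants' `hb` verbatim): with
`Cw := max 1 (∑_{j ∈ T} (1 + |m_j − n_j|)²)` (`1 ≤ Cw` = `hCw1`) and naturals `M₁ ≥ e₁`, `M₂ ≥ e₂`,
`(#value pairs : ℝ) ≤ Cw · ((1 + M₁) · (1 + M₂))`. -/
theorem ncard_image_valuePair_sol_le_real (v : Valuation F (WithZero (Multiplicative ℤ))) (a b c d : F)
    (ha : a ≠ 0) (hb : b ≠ 0) (hc : c ≠ 0) (hd : d ≠ 0) (hdet : a * d - b * c ≠ 0)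
    {ι : Type*} (T : Finset ι) (D : ι → Set (Matrix (Fin 2) (Fin 2) F))
    (u δ : ι → WithZero (Multiplicative ℤ)) (hu : ∀ j, u j ≠ 0) (hδ : ∀ j, δ j ≠ 0)
    (m n : ι → ℤ) (hm : ∀ j, ord (hu j) = -min (m j) (n j)) (hn : ∀ j, ord (hδ j) = -(m j + n j))
    (hD : ∀ j ∈ T, ∀ M ∈ D j, (∀ i k, v (M i k) ≤ u j) ∧ v M.det = δ j)
    (U : Set (Matrix (Fin 2) (Fin 2) F)) (hcov : U ⊆ ⋃ j ∈ T, D j)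
    (M₁ M₂ : ℕ)
    (he₁ : ord ((Valuation.ne_zero_iff v).2 hdet) - ord ((Valuation.ne_zero_iff v).2 ha) -
            ord ((Valuation.ne_zero_iff v).2 hd) ≤ M₁)
    (he₂ : ord ((Valuation.ne_zero_iff v).2 hdet) - ord ((Valuation.ne_zero_iff v).2 hb) -
            ord ((Valuation.ne_zero_iff v).2 hc) ≤ M₂) :
    ((valuePair v '' sol a b c d U).ncard : ℝ) ≤
      max (1 : ℝ) ((∑ j ∈ T, (1 + |m j - n j|) ^ 2 : ℤ) : ℝ) * ((1 + (M₁ : ℝ)) * (1 + (M₂ : ℝ))) := by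
  have h := ncard_image_valuePair_sol_le_const v a b c d ha hb hc hd hdet T D u δ hu hδ m n hm hn hD U hcov
    M₁ M₂ (Nat.cast_nonneg _) (Nat.cast_nonneg _) he₁ he₂
  have hS : (0 : ℝ) ≤ ((∑ j ∈ T, (1 + |m j - n j|) ^ 2 : ℤ) : ℝ) := by
    rw [Int.cast_sum]
    exact Finset.sum_nonneg fun j _ => by positivity
  have hR : ((valuePair v '' sol a b c d U).ncard : ℝ) ≤
      ((∑ j ∈ T, (1 + |m j - n j|) ^ 2 : ℤ) : ℝ) * ((1 + (M₁ : ℝ)) * (1 + (M₂ : ℝ))) := by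
    have := (Int.cast_le (R := ℝ)).2 h
    push_cast at this ⊢
    exact this
  refine hR.trans (mul_le_mul_of_nonneg_right (le_max_right _ _) (by positivity))

end Cartan





end Summit.Ventures.HodgeRepro2.Tier7.Line3.CoverCountLink
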